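import Literature.MathematicalPhysics.QuantumFieldTheory.Balaban1983to89.B7Prop5GeneralOperatorFacts
import Literature.MathematicalPhysics.QuantumFieldTheory.Balaban1983to89.B7Prop4GeneralLevels

/-!
# B7 Proposition 5 at a general background — file 2: the induction (143)–(147) for the composed linear part
# `Q_j(U₀)` = `B7Prop4GeneralLevels.linCovIter`, PER BOND, over the one-step majorant (139) as hypothesis
# (`B7Prop5GeneralLinear`)

CITATION HEADER (lean-in-tree rule 2026-08-18).  Audit cell `pub-balaban`, sub-cell `t4`, NE7c ROUND-2 crew seat
`b2b-balaban-t4-ne7c-formalise-leaf-10` gen 10; owner table `t4/b2b-balaban-t4-ne7c-p1/LEAVES-NE7c-P1.md` row **S68 (c)**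
«[B7] Prop. 5 at a general regular background — the k-fold composition».  Source: T. Bałaban, *Averaging operations for
lattice gauge theories*, Commun. Math. Phys. **98**, 17–51 (1985) [Balaban1985Averaging] (cell paper B7; journal page =
PDF page + 16), Sect. D pp. 39–40 [PDF 23–24], renders `…/1985-cmp98-averaging-p023-x2.png`, `-p024-x2.png` READ AS
IMAGES by this seat (2026-08-20).  Companions REUSED BY NAME: `B7Prop5GeneralOperators` / `B7Prop5GeneralOperatorFacts`
(this seat: `avQ`, `ddQ`, `kerQ`, `kerQdd`, the operator facts), `B7Prop4GeneralLevels` (`linCovIter` = the composite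
«Q_{j+1}(U₀) = Q(Ū₀ʲ)Q_j(U₀)» of the one-step linear parts `B7Prop3GeneralLinear.linQcov` at the level backgrounds
`Ū₀ʲ = avgIter L U₀ j`), `B7Prop5Flat` (`bump` = the single-bond direction of (138), `S1`, `restr`, `bondIn_line`,
`mem_bondsIn`, `agreeOn_insCfg_restr`), `B7Prop3Flat` (`insCfg`, `insCfg_smul`, `norm_insCfg_le`).

THE PRINTED TEXT (p. 39 [PDF 23] – p. 40 [PDF 24], verbatim): «We would like to prove that the functional derivative of
Q_k(U₀, ηA) is bounded by a constant independent of η. This property is not clear even for the linear part of Q_k, so let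
us start with an analysis of this linear part. … From (124) it is clear that we have the inequalities |Q_{V₀}A| ≦ Q|A|,
|Q″(V₀)A| ≦ C′₁L²α₀Q″|A|, (139) … Now we will prove by induction the bound |Q_j(U₀)A| ≦ Q_j|A| + 2C′₁α₀(Lʲη)²Q″_j|A|,
j ≦ k, (143) assuming that U₀ satisfies the bound (52). For j = 1 it is a consequence of (139). We assume (143) for j < k
and we have |Q_{j+1}(U₀)A| = |Q(Ū₀ʲ)Q_j(U₀)A| ≦ Q|Q_j(U₀)A| + C′₁2α₀(Lʲη)²Q″|Q_j(U₀)A| ≦ … (144) by (139) and Proposition 2.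
Further using the inequalities (142), QQ″_j|A| ≦ 2Q″_{j+1}|A|, and Q″Q_j|A| ≦ Q″_{j+1}|A|, we get |Q_{j+1}(U₀)A| ≦ Q_{j+1}|A|
+ 2C′₁α₀(L^{j+1}η)²Q″_{j+1}|A|·(2L^{−2} + L^{−2} + 4dC′₁α₀L^{−4}). (145) Because 2L^{−2} + L^{−2} + 4dC′₁α₀L^{−4} ≦ ¾ +
4dC′₁L^{−4}α₀ ≦ 1 if 16dC′₁L^{−4}α₀ ≦ 1, so the bound (143) is proved for all j ≦ k. For j = k we have |Q_k(U₀)A| ≦ Q_k|A| +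
2C′₁α₀Q″_k|A| ≦ (1 + 2C′₁α₀)Q″_k|A|, (146) and this bound implies the required property, namely (δ/δA_b)(Q_k(U₀)A)_c =
Q_k(U₀; c, b), |Q_k(U₀; c, b)| ≦ 1 + 2C′₁α₀. (147)»

DICTIONARY (b07 / `B7Prop4GeneralLevels` conventions; `B = ηA`, every level rescaled to `ℤᵈ`).  The composed linear part
`LʲηQ_j(U₀)A` ↦ `linCovIter L U₀ B j`; the single-bond variation `A ↦ X·δ_b`, `b = ⟨y, y + e_μ⟩` ↦ `bump y μ X`; the
column `Q_j(U₀; ·, b)` of (147) is read through `‖linCovIter L U₀ (bump y μ X) j (c)‖`; (139) at the background `V₀ = Ū₀ʲ`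
↦ the HYPOTHESIS `h139` below, in the un-normalised currency of `B7Prop5GeneralOperators` (`avQ = L·Q`, `ddQ = Q″`) and
with a level coefficient `θ·s_j·L`, `s_j = (Lʲ/Lᵏ)² = (Lʲη)²`, `θ` standing for print's `2C′₁α₀` in the post-(144)
convention `C′₁ ↔ L²C′₁` (cell note N-B7-D144) — print's «C′₁2α₀(Lʲη)²Q″» of (144), the extra `L` being the
un-normalisation `L(Q(V₀)A)_c` of (122); (143)ⱼ ↦ `‖linCovIter L U₀ (bump y μ X) j c‖ ≤ (kerQ L j c b + θ·s_j·Lʲ·kerQdd L j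
c b)·‖X‖` (the `Lʲ` = un-normalisation of `Q_j`); the closing condition «16dC′₁L^{−4}α₀ ≦ 1» ↦ `8dθL^{−4} ≤ 1`.

WHAT THIS FILE PROVES (kernel, 0 sorry), for `L ≥ 2`:
* §1 sizes and locality of the one-step operators (`avQ_le_of_le`, `ddQ_le_of_le`, `avQ_eq_zero_of_box`,
  `ddQ_eq_zero_of_box`);
* §2 consequences of the majorant (139) for ONE step at a background `V` (hypotheses `hadd`/`hsmul` = additivity and
  homogeneity of `A ↦ L(Q(V)A)_c`, `h139` = the majorant): LOCALITY `linQcov_local` («depends only on A_b, b ⊂ B(c₋) ∪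
  B(c₊)»), `isBoundedLinearMap_linQcov_ins` (the linear part is a bounded linear map of the finitely many variables of the
  box — the carrier of the chain rule (153)), `hasDerivAt_linQcov_family`;
* §3 AT THE LEVEL BACKGROUNDS `Ū₀ʲ`: `linCovIter_line` (affine along complex lines), **`ineq143`** = (143)ⱼ for all `j ≤ k`
  PER BOND by the printed induction (144)–(145) — the operator facts of `B7Prop5GeneralOperatorFacts` supply «QQ_j =
  Q_{j+1}», «QQ″_j ≦ (2 − L^{−1})Q″_{j+1}», «Q″Q_j ≦ Q″_{j+1}», (142) —, **`ineq147`** = (146)/(147): `‖linCovIter L U₀ (bump y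
  μ X) j c‖ ≤ (1 + θs_j)·Lʲ·L^{−jd}·‖X‖` (at `j = k`: `(1 + 2C′₁α₀)·η^d` per unit of `X`, (147) with (138)'s `η^{−d}`), and
  `linCovIter_bump_eq_zero` (locality: zero unless `b ⊂ Bʲ(c₋) ∪ Bʲ(c₊)`).
ABSOLUTE-RULE LEDGER: the one-step inputs ((139) in majorant form, additivity/homogeneity of the linear part in the regime)
enter as HYPOTHESES about `linQcov` at the backgrounds `avgIter L U₀ j`, `j < k` — discharged in the Summits-side assembly
from row S68 (a) and `B7Prop3GeneralTild.linQcov_add/_smul`; nothing of the manuscript is cited as a fact; no `def … : Prop`.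
HONEST (cell): B7-internal bookkeeping on OUR side of WALL §2 (a); NE7c NOT PRINTED, NOT PROVED; spine PROVED 0/9; rung
(B)+1 on a FINITE T⁴ — NOT infinite volume, NOT mass gap, NOT Clay.  HONEST DEPENDENCY: continuum YM on T⁴ ⇐ BetaPertH ∧
nine spine estimates (0/9 proved); BetaPertH ⇐ (D1) ∧ (D4) ∧ CAP+tail; G-an2-4 gates asym, D1 and NE2/3/4.
-/

noncomputable section

open scoped BigOperators
open Finset

namespace Literature.MathematicalPhysics.QuantumFieldTheory.Balaban1983to89.B7Prop5GeneralLinear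

open B7Prop1Explicit B7Prop1Local B7Prop2Explicit B7Prop3Flat B7Prop4Flat B7Prop5Flat B7Eq92Concrete
  B7Prop3GeneralLinear B7Prop4GeneralLevels B7Prop5GeneralOperators B7Prop5GeneralOperatorFacts

export B7Prop1Explicit (Site)

variable {d : ℕ} {𝔸 : Type*} [NormedRing 𝔸] [NormedAlgebra ℂ 𝔸] [CompleteSpace 𝔸]

/-! ## §1 Sizes and locality of the one-step operators -/

omit [NormedAlgebra ℂ 𝔸] [CompleteSpace 𝔸] in
/-- `Q1 = 1`: `L·(Qg)_c ≤ L·M` for `g ≤ M` (the normalisation of the straight-line average, (125)). [cite: Balaban1985Averaging, (125) p.36, (139) p.39] -/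
theorem avQ_le_of_le (L : ℕ) (hL : 1 ≤ L) {g : Site d → Fin d → ℝ} {M : ℝ} (hg : ∀ x κ, g x κ ≤ M) (q : Site d)
    (κ : Fin d) : avQ L g q κ ≤ L * M := by
  unfold avQ
  have hL0 : (L : ℝ) ≠ 0 := by exact_mod_cast (by omega : L ≠ 0)
  calc ∑ r : Fin d → Fin L, ((L : ℝ) ^ d)⁻¹ * ∑ i : Fin L, g (q + boxVec L r + ((i : ℕ) : ℤ) • e κ) κ
      ≤ ∑ _r : Fin d → Fin L, ((L : ℝ) ^ d)⁻¹ * ∑ _i : Fin L, M :=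
        sum_le_sum fun r _ => mul_le_mul_of_nonneg_left (sum_le_sum fun i _ => hg _ _) (by positivity)
    _ = L * M := by
        simp only [sum_const, card_univ, Fintype.card_fin, Fintype.card_pi, prod_const, nsmul_eq_mul]
        push_cast
        rw [← mul_assoc, ← mul_assoc, mul_inv_cancel₀ (pow_ne_zero d hL0), one_mul]

omit [NormedAlgebra ℂ 𝔸] [CompleteSpace 𝔸] in
/-- `(Q″g)_c ≤ L^{−d}·#{b ⊂ B(c₋)∪B(c₊)}·M` for `g ≤ M` (the finitely many variables of (140)). [cite: Balaban1985Averaging, (140) p.39] -/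
theorem ddQ_le_of_le (L : ℕ) {g : Site d → Fin d → ℝ} {M : ℝ} (hg : ∀ x κ, g x κ ≤ M) (q : Site d) (κ : Fin d) :
    ddQ L g q κ ≤ ((L : ℝ) ^ d)⁻¹ * (S1 L q κ).card * M := by
  unfold ddQ
  rw [mul_assoc]
  refine mul_le_mul_of_nonneg_left ?_ (by positivity)
  calc ∑ b ∈ S1 L q κ, g b.1 b.2 ≤ ∑ _b ∈ S1 L q κ, M := sum_le_sum fun b _ => hg _ _
    _ = (S1 L q κ).card * M := by rw [sum_const, nsmul_eq_mul]

omit [NormedAlgebra ℂ 𝔸] [CompleteSpace 𝔸] in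
/-- LOCALITY of `L·Q`: it reads `g` only on bonds of `B(c₋) ∪ B(c₊)` (`bondIn_line`). [cite: Balaban1985Averaging, p.24 (after (43)), (125) p.36] -/
theorem avQ_eq_zero_of_box (L : ℕ) {g : Site d → Fin d → ℝ} (z : Site d) (κ : Fin d)
    (hg : ∀ x μ', BondIn ((L : ℤ) • z) (bondHi L ((L : ℤ) • z) κ) x μ' → g x μ' = 0) :
    avQ L g ((L : ℤ) • z) κ = 0 :=
  sum_eq_zero fun r _ => by rw [sum_eq_zero fun i _ => hg _ _ (bondIn_line L z κ r i), mul_zero]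

omit [NormedAlgebra ℂ 𝔸] [CompleteSpace 𝔸] in
/-- LOCALITY of `Q″` (140): it reads `g` only on bonds of `B(c₋) ∪ B(c₊)`. [cite: Balaban1985Averaging, (140) p.39] -/
theorem ddQ_eq_zero_of_box (L : ℕ) {g : Site d → Fin d → ℝ} (q : Site d) (κ : Fin d)
    (hg : ∀ x μ', BondIn q (bondHi L q κ) x μ' → g x μ' = 0) : ddQ L g q κ = 0 := by
  have h0 : ∑ b ∈ S1 L q κ, g b.1 b.2 = 0 := sum_eq_zero fun b hb => hg _ _ (mem_bondsIn.1 hb)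
  rw [ddQ, h0, mul_zero]

omit [NormedAlgebra ℂ 𝔸] [CompleteSpace 𝔸] in
/-- the insertion `insCfg` of b07 is additive in the variables. [folklore] -/
private theorem insCfg_add (S : Finset (Site d × Fin d)) (a a' : S → 𝔸) :
    insCfg S (a + a') = insCfg S a + insCfg S a' := by
  funext x κ
  by_cases h : (x, κ) ∈ S <;> simp [insCfg, h]

/-! ## §2 One step at a background `V`: locality and continuity of the linear part from the majorant (139) -/

section OneStep

variable (L : ℕ) (V : Site d → Fin d → 𝔸ˣ) (z : Site d) (κ : Fin d) {e₁ : ℝ}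
  (hadd : ∀ F G : Site d → Fin d → 𝔸,
    linQcov L V (F + G) ((L : ℤ) • z) κ = linQcov L V F ((L : ℤ) • z) κ + linQcov L V G ((L : ℤ) • z) κ)
  (hsmul : ∀ (t : ℂ) (F : Site d → Fin d → 𝔸), linQcov L V (t • F) ((L : ℤ) • z) κ = t • linQcov L V F ((L : ℤ) • z) κ)
  (h139 : ∀ G : Site d → Fin d → 𝔸, ‖linQcov L V G ((L : ℤ) • z) κ‖ ≤
    avQ L (fun x κ' => ‖G x κ'‖) ((L : ℤ) • z) κ + e₁ * ddQ L (fun x κ' => ‖G x κ'‖) ((L : ℤ) • z) κ)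

include hadd in
/-- additivity gives `L(Q(V)(F − G))_c = L(Q(V)F)_c − L(Q(V)G)_c`. [cite: Balaban1985Averaging, (122) p.36] -/
theorem linQcov_sub' (F G : Site d → Fin d → 𝔸) :
    linQcov L V (F - G) ((L : ℤ) • z) κ = linQcov L V F ((L : ℤ) • z) κ - linQcov L V G ((L : ℤ) • z) κ := by
  have h := hadd (F - G) G
  rw [sub_add_cancel] at h
  rw [h, add_sub_cancel_right]

include hadd h139 in
/-- **LOCALITY OF THE ONE-STEP LINEAR PART** (p. 34: the one-step function is «an analytic function of the variables A_b,
b ⊂ B(c₋) ∪ B(c₊)»; read off the majorant (139), whose operators see only those bonds): two fields agreeing on the bonds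
of `B(c₋) ∪ B(c₊)` have the same `L(Q(V)·)_c`. [cite: Balaban1985Averaging, p.34 (before (122)), (139)–(140) p.39] -/
theorem linQcov_local {F F' : Site d → Fin d → 𝔸} (h : AgreeOn ((L : ℤ) • z) (bondHi L ((L : ℤ) • z) κ) F F') :
    linQcov L V F ((L : ℤ) • z) κ = linQcov L V F' ((L : ℤ) • z) κ := by
  have hg : ∀ x μ', BondIn ((L : ℤ) • z) (bondHi L ((L : ℤ) • z) κ) x μ' → ‖(F - F') x μ'‖ = 0 := fun x μ' hx => by
    rw [Pi.sub_apply, Pi.sub_apply, h x μ' hx.1 hx.2, sub_self, norm_zero]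
  have h0 : linQcov L V (F - F') ((L : ℤ) • z) κ = 0 := by
    have hb := h139 (F - F')
    rw [avQ_eq_zero_of_box L z κ hg, ddQ_eq_zero_of_box L _ κ hg, mul_zero, add_zero] at hb
    exact norm_le_zero_iff.1 hb
  rw [linQcov_sub' L V z κ hadd] at h0
  exact sub_eq_zero.1 h0

include hadd h139 in
/-- `L(Q(V)F)_c` is a function of the finitely many variables `F_b`, `b ∈ S1` (the bonds of `B(c₋) ∪ B(c₊)`): it equals
its value at the insertion of the restriction. [cite: Balaban1985Averaging, p.34 (before (122)), (140) p.39] -/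
theorem linQcov_ins (F : Site d → Fin d → 𝔸) :
    linQcov L V F ((L : ℤ) • z) κ =
      linQcov L V (insCfg (S1 L ((L : ℤ) • z) κ) (restr (S1 L ((L : ℤ) • z) κ) F)) ((L : ℤ) • z) κ :=
  linQcov_local L V z κ hadd h139 (agreeOn_insCfg_restr _ _ F)

include hadd hsmul h139 in
/-- **THE ONE-STEP LINEAR PART IS A BOUNDED LINEAR MAP OF THE BOX VARIABLES** `𝔸^{S1} → 𝔸` (additive, homogeneous, and
bounded by `(L + e₁·L^{−d}·#S1)·‖a‖` through the majorant (139) with `Q1 = 1`) — the carrier of the chain rule (153).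
[cite: Balaban1985Averaging, (139) p.39, (153) p.41] -/
theorem isBoundedLinearMap_linQcov_ins (he₁ : 0 ≤ e₁) (hL : 1 ≤ L) :
    IsBoundedLinearMap ℂ (fun a : ↥(S1 L ((L : ℤ) • z) κ) → 𝔸 =>
      linQcov L V (insCfg (S1 L ((L : ℤ) • z) κ) a) ((L : ℤ) • z) κ) := by
  set S := S1 L ((L : ℤ) • z) κ with hS
  refine { map_add := fun a a' => ?_, map_smul := fun t a => ?_, bound := ?_ }
  · simp only [insCfg_add, hadd]
  · simp only [insCfg_smul, hsmul]
  · refine ⟨(L : ℝ) + e₁ * (((L : ℝ) ^ d)⁻¹ * S.card) + 1, by positivity, fun a => ?_⟩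
    have hn : ∀ x κ', ‖insCfg S a x κ'‖ ≤ ‖a‖ := fun x κ' => norm_insCfg_le S a x κ'
    have h1 : avQ L (fun x κ' => ‖insCfg S a x κ'‖) ((L : ℤ) • z) κ ≤ L * ‖a‖ := avQ_le_of_le L hL hn _ κ
    have h2 : ddQ L (fun x κ' => ‖insCfg S a x κ'‖) ((L : ℤ) • z) κ ≤ ((L : ℝ) ^ d)⁻¹ * S.card * ‖a‖ :=
      ddQ_le_of_le L hn _ κ
    calc ‖linQcov L V (insCfg S a) ((L : ℤ) • z) κ‖
        ≤ avQ L (fun x κ' => ‖insCfg S a x κ'‖) ((L : ℤ) • z) κ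
            + e₁ * ddQ L (fun x κ' => ‖insCfg S a x κ'‖) ((L : ℤ) • z) κ := h139 _
      _ ≤ L * ‖a‖ + e₁ * (((L : ℝ) ^ d)⁻¹ * S.card * ‖a‖) := add_le_add h1 (mul_le_mul_of_nonneg_left h2 he₁)
      _ ≤ ((L : ℝ) + e₁ * (((L : ℝ) ^ d)⁻¹ * S.card) + 1) * ‖a‖ := by
          have := norm_nonneg a; nlinarith

include hadd hsmul h139 in
/-- **the term `Q(Ū₀ʲ)⟨δC_j/δA, δA⟩` of (153)**: along a family of fields differentiable at `t = 0` bondwise, the one-step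
linear part is differentiable with derivative the linear part of the derivative field (a bounded linear map of finitely
many variables commutes with `d/dt`). [cite: Balaban1985Averaging, (153) p.41, (139) p.39] -/
theorem hasDerivAt_linQcov_family (he₁ : 0 ≤ e₁) (hL : 1 ≤ L) {Φ : ℂ → Site d → Fin d → 𝔸}
    {Φ' : Site d → Fin d → 𝔸} (h : ∀ x μ', HasDerivAt (fun t => Φ t x μ') (Φ' x μ') 0) :
    HasDerivAt (fun t => linQcov L V (Φ t) ((L : ℤ) • z) κ) (linQcov L V Φ' ((L : ℤ) • z) κ) 0 := by
  set S := S1 L ((L : ℤ) • z) κ with hS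
  set Λ := (isBoundedLinearMap_linQcov_ins L V z κ hadd hsmul h139 he₁ hL).toContinuousLinearMap with hΛ
  have hρ : HasDerivAt (fun t : ℂ => restr S (Φ t)) (restr S Φ') 0 := hasDerivAt_pi.2 fun s => h s.1.1 s.1.2
  have hcomp := Λ.hasFDerivAt.comp_hasDerivAt (0 : ℂ) hρ
  have hval : ∀ F : Site d → Fin d → 𝔸, Λ (restr S F) = linQcov L V F ((L : ℤ) • z) κ := fun F =>
    (linQcov_ins L V z κ hadd h139 F).symm
  simp only [Function.comp_def, hval] at hcomp
  exact hcomp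

end OneStep

/-! ## §3 At the level backgrounds `Ū₀ʲ`: (143)–(147) per bond -/

section Levels

variable (L : ℕ) (hL : 2 ≤ L) (U₀ : Site d → Fin d → 𝔸ˣ) (k : ℕ) {θ : ℝ} (hθ : 0 ≤ θ)
  (hadd : ∀ j < k, ∀ (F G : Site d → Fin d → 𝔸) (z : Site d) (κ : Fin d),
    linQcov L (avgIter L U₀ j) (F + G) ((L : ℤ) • z) κ =
      linQcov L (avgIter L U₀ j) F ((L : ℤ) • z) κ + linQcov L (avgIter L U₀ j) G ((L : ℤ) • z) κ)
  (hsmul : ∀ j < k, ∀ (t : ℂ) (F : Site d → Fin d → 𝔸) (z : Site d) (κ : Fin d),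
    linQcov L (avgIter L U₀ j) (t • F) ((L : ℤ) • z) κ = t • linQcov L (avgIter L U₀ j) F ((L : ℤ) • z) κ)
  (h139 : ∀ j < k, ∀ (G : Site d → Fin d → 𝔸) (z : Site d) (κ : Fin d),
    ‖linQcov L (avgIter L U₀ j) G ((L : ℤ) • z) κ‖ ≤
      avQ L (fun x κ' => ‖G x κ'‖) ((L : ℤ) • z) κ
        + θ * ((L : ℝ) ^ j * ((L : ℝ) ^ k)⁻¹) ^ 2 * (L : ℝ) * ddQ L (fun x κ' => ‖G x κ'‖) ((L : ℤ) • z) κ)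
  (h145 : 8 * d * θ * (L : ℝ)⁻¹ ^ 4 ≤ 1)

include hadd hsmul in
/-- the composed linear part is AFFINE ALONG COMPLEX LINES: `LʲηQ_j(U₀)(B + tD) = LʲηQ_j(U₀)B + t·LʲηQ_j(U₀)D` (additivity
and homogeneity of every factor «Q_{j+1}(U₀) = Q(Ū₀ʲ)Q_j(U₀)»), hence its `t`-derivative is `LʲηQ_j(U₀)D` — the terms
`L^{−1}Q_j(U₀)δA` of (153). [cite: Balaban1985Averaging, p.38 (before (133)), (153) p.41] -/
theorem linCovIter_line (B D : Site d → Fin d → 𝔸) :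
    ∀ j ≤ k, ∀ (t : ℂ) (x : Site d) (κ : Fin d),
      linCovIter L U₀ (B + t • D) j x κ = linCovIter L U₀ B j x κ + t • linCovIter L U₀ D j x κ := by
  intro j
  induction j with
  | zero => intro _ t x κ; rfl
  | succ j ih =>
    intro hjk t x κ
    have hj : j < k := Nat.lt_of_succ_le hjk
    have hfun : linCovIter L U₀ (B + t • D) j = linCovIter L U₀ B j + t • linCovIter L U₀ D j :=
      funext fun x' => funext fun κ' => ih hj.le t x' κ'
    rw [linCovIter_succ, hfun, hadd j hj, hsmul j hj, linCovIter_succ, linCovIter_succ]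

include hadd hsmul in
/-- … so `t ↦ LʲηQ_j(U₀)(B + tD)(c)` has derivative `LʲηQ_j(U₀)D(c)` at `t = 0`. [cite: Balaban1985Averaging, (153) p.41] -/
theorem hasDerivAt_linCovIter_line (B D : Site d → Fin d → 𝔸) {j : ℕ} (hj : j ≤ k) (x : Site d) (κ : Fin d) :
    HasDerivAt (fun t : ℂ => linCovIter L U₀ (B + t • D) j x κ) (linCovIter L U₀ D j x κ) 0 := by
  have h : ∀ t : ℂ, linCovIter L U₀ (B + t • D) j x κ = linCovIter L U₀ B j x κ + t • linCovIter L U₀ D j x κ :=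
    fun t => linCovIter_line L U₀ k hadd hsmul B D j hj t x κ
  simp_rw [h]
  exact (((hasDerivAt_id (0 : ℂ)).smul_const (linCovIter L U₀ D j x κ)).const_add _).congr_deriv (one_smul _ _)

/-- the closing arithmetic of (145) in the un-normalised currency: `(2L − 1) + L + 2dθsL ≤ L³` for `s ≤ L^{−2}`,
`8dθL^{−4} ≤ 1`, `L ≥ 2` — print's «2L^{−2} + L^{−2} + 4dC′₁α₀L^{−4} ≦ ¾ + 4dC′₁L^{−4}α₀ ≦ 1 if 16dC′₁L^{−4}α₀ ≦ 1» after
multiplication by `L³` (with the sharp `2 − L^{−1}` for the printed `2`). [cite: Balaban1985Averaging, (145) p.40] -/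
theorem ineq145_arith {L d θ s : ℝ} (hL : 2 ≤ L) (hd : 0 ≤ d) (hθ : 0 ≤ θ) (hsL : s ≤ L⁻¹ ^ 2)
    (h145 : 8 * d * θ * L⁻¹ ^ 4 ≤ 1) : (2 * L - 1) + L + 2 * d * θ * s * L ≤ L ^ 3 := by
  have hL0 : 0 < L := by linarith
  have hLinv : L * L⁻¹ = 1 := mul_inv_cancel₀ hL0.ne'
  have h1 : 2 * d * θ * s * L ≤ 2 * d * θ * L⁻¹ := by
    have := mul_le_mul_of_nonneg_left hsL (by positivity : 0 ≤ 2 * d * θ * L)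
    calc 2 * d * θ * s * L = 2 * d * θ * L * s := by ring
      _ ≤ 2 * d * θ * L * L⁻¹ ^ 2 := this
      _ = 2 * d * θ * L⁻¹ * (L * L⁻¹) := by ring
      _ = 2 * d * θ * L⁻¹ := by rw [hLinv, mul_one]
  have h2 : 2 * d * θ * L⁻¹ ≤ L ^ 3 / 4 := by
    have := mul_le_mul_of_nonneg_left h145 (by positivity : 0 ≤ L ^ 3 / 4)
    calc 2 * d * θ * L⁻¹ = L ^ 3 / 4 * (8 * d * θ * L⁻¹ ^ 4) * 1 := by
          field_simp
          ring
      _ ≤ L ^ 3 / 4 * 1 * 1 := by nlinarith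
      _ = L ^ 3 / 4 := by ring
  have hsq : 4 ≤ L ^ 2 := by nlinarith
  have hL3 : 4 * L ≤ L ^ 3 := by
    have := mul_le_mul_of_nonneg_left hsq hL0.le
    calc 4 * L = L * 4 := by ring
      _ ≤ L * L ^ 2 := this
      _ = L ^ 3 := by ring
  linarith

include hL hθ h139 h145 in
/-- **(143) FOR ALL `j ≤ k`, PER BOND** — the printed induction (144)–(145): for the single-bond direction `X·δ_b`,
`b = ⟨y, y + e_μ⟩`, and every bond `c` of the `j`-th lattice, `‖LʲηQ_j(U₀)(X·δ_b)(c)‖ ≤ (kerQ(c, b) + θ·(Lʲη)²·Lʲ·kerQdd(c,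
b))·‖X‖` — «|Q_j(U₀)A| ≦ Q_j|A| + 2C′₁α₀(Lʲη)²Q″_j|A|» column by column (base `j = 0`: `Q_0(U₀) = 1`; step: (139) at `Ū₀ʲ`
= `h139`, then «QQ_j = Q_{j+1}», «QQ″_j ≦ (2 − L^{−1})Q″_{j+1}», «Q″Q_j ≦ Q″_{j+1}», (142) from
`B7Prop5GeneralOperatorFacts`, and the closing arithmetic `ineq145_arith` under «16dC′₁L^{−4}α₀ ≦ 1»).
[cite: Balaban1985Averaging, (143)–(145) pp.39–40] -/
theorem ineq143 (y : Site d) (μ : Fin d) (X : 𝔸) :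
    ∀ j ≤ k, ∀ (x : Site d) (κ : Fin d),
      ‖linCovIter L U₀ (bump y μ X) j x κ‖ ≤
        (kerQ L j x κ y μ + θ * ((L : ℝ) ^ j * ((L : ℝ) ^ k)⁻¹) ^ 2 * (L : ℝ) ^ j * kerQdd L j x κ y μ) * ‖X‖ := by
  have hL1 : 1 ≤ L := le_trans (by norm_num) hL
  have hLr : (2 : ℝ) ≤ L := by exact_mod_cast hL
  have hLpos : (0 : ℝ) < L := by linarith
  intro j
  induction j with
  | zero =>
    intro _ x κ
    rw [linCovIter_zero, kerQ_zero]
    have hdd := kerQdd_nonneg L 0 x κ y μ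
    by_cases h : x = y ∧ κ = μ
    · rw [if_pos h]
      have hb : ‖bump y μ X x κ‖ = ‖X‖ := by simp [bump, h]
      rw [hb]
      have : 0 ≤ θ * ((L : ℝ) ^ 0 * ((L : ℝ) ^ k)⁻¹) ^ 2 * (L : ℝ) ^ 0 * kerQdd L 0 x κ y μ * ‖X‖ := by positivity
      nlinarith
    · rw [if_neg h, bump_eq_zero_of X h, norm_zero]
      positivity
  | succ j ih =>
    intro hjk z κ
    have hj : j < k := Nat.lt_of_succ_le hjk
    set s : ℝ := ((L : ℝ) ^ j * ((L : ℝ) ^ k)⁻¹) ^ 2 with hs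
    have hs0 : 0 ≤ s := by positivity
    have hsL : s ≤ (L : ℝ)⁻¹ ^ 2 := by
      -- `(Lʲ/Lᵏ)² ≤ L⁻²` for `j < k`
      have hLk : (0 : ℝ) < (L : ℝ) ^ k := by positivity
      have hjk' : (L : ℝ) ^ j * (L : ℝ) ≤ (L : ℝ) ^ k := by
        rw [← pow_succ]; exact pow_le_pow_right₀ (by linarith) hjk
      have hratio : (L : ℝ) ^ j * ((L : ℝ) ^ k)⁻¹ ≤ (L : ℝ)⁻¹ := by
        rw [mul_inv_le_iff₀ hLk, inv_mul_eq_div, le_div_iff₀ hLpos]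
        exact hjk'
      have h0 : 0 ≤ (L : ℝ) ^ j * ((L : ℝ) ^ k)⁻¹ := by positivity
      rw [hs]; exact pow_le_pow_left₀ h0 hratio 2
    have hs' : ((L : ℝ) ^ (j + 1) * ((L : ℝ) ^ k)⁻¹) ^ 2 = (L : ℝ) ^ 2 * s := by rw [hs, pow_succ]; ring
    set G := linCovIter L U₀ (bump y μ X) j with hG
    set C : ℝ := θ * s * (L : ℝ) ^ j * ‖X‖ with hC
    have hC0 : 0 ≤ C := by positivity
    have hGb : ∀ x κ', ‖G x κ'‖ ≤ ‖X‖ * kerQ L j x κ' y μ + C * kerQdd L j x κ' y μ := fun x κ' => by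
      have := ih hj.le x κ'
      rw [hC]; linarith [this]
    set W := kerQdd L (j + 1) z κ y μ with hW
    have hW0 : 0 ≤ W := kerQdd_nonneg L (j + 1) z κ y μ
    -- `Q` through (143)ⱼ: «QQ_j = Q_{j+1}», «QQ″_j ≤ (2 − L⁻¹)Q″_{j+1}»
    have hav : avQ L (fun x κ' => ‖G x κ'‖) ((L : ℤ) • z) κ ≤
        ‖X‖ * kerQ L (j + 1) z κ y μ + C * ((2 * (L : ℝ) - 1) * W) := by
      calc avQ L (fun x κ' => ‖G x κ'‖) ((L : ℤ) • z) κ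
          ≤ avQ L (fun x κ' => ‖X‖ * kerQ L j x κ' y μ + C * kerQdd L j x κ' y μ) ((L : ℤ) • z) κ := avQ_mono L hGb _ _
        _ = ‖X‖ * avQ L (fun x κ' => kerQ L j x κ' y μ) ((L : ℤ) • z) κ
              + C * avQ L (fun x κ' => kerQdd L j x κ' y μ) ((L : ℤ) • z) κ := by
            rw [avQ_add, avQ_smul, avQ_smul]
        _ ≤ _ := by
            rw [avQ_kerQ]
            exact add_le_add le_rfl (mul_le_mul_of_nonneg_left (avQ_kerQdd_le L hL1 j z κ y μ) hC0)
    -- `Q″` through (143)ⱼ: «Q″Q_j ≤ Q″_{j+1}», (142)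
    have hdd : ddQ L (fun x κ' => ‖G x κ'‖) ((L : ℤ) • z) κ ≤ ‖X‖ * ((L : ℝ) ^ j * W) + C * (2 * d * W) := by
      calc ddQ L (fun x κ' => ‖G x κ'‖) ((L : ℤ) • z) κ
          ≤ ddQ L (fun x κ' => ‖X‖ * kerQ L j x κ' y μ + C * kerQdd L j x κ' y μ) ((L : ℤ) • z) κ := ddQ_mono L hGb _ _
        _ = ‖X‖ * ddQ L (fun x κ' => kerQ L j x κ' y μ) ((L : ℤ) • z) κ
              + C * ddQ L (fun x κ' => kerQdd L j x κ' y μ) ((L : ℤ) • z) κ := by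
            rw [ddQ_add, ddQ_smul, ddQ_smul]
        _ ≤ _ := add_le_add (mul_le_mul_of_nonneg_left (ddQ_kerQ_le L hL1 j z κ y μ) (norm_nonneg X))
              (mul_le_mul_of_nonneg_left (ddQ_kerQdd_le L hL1 j z κ y μ) hC0)
    -- (144)–(145)
    have h1 := h139 j hj G z κ
    have harith := ineq145_arith (d := (d : ℝ)) hLr (Nat.cast_nonneg d) hθ hsL h145
    have hθsL : 0 ≤ θ * s * (L : ℝ) := by positivity
    rw [linCovIter_succ, hs']
    have key : θ * s * (L : ℝ) ^ j * ‖X‖ * W * ((2 * L - 1) + L + 2 * d * θ * s * L)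
        ≤ θ * s * (L : ℝ) ^ j * ‖X‖ * W * (L : ℝ) ^ 3 :=
      mul_le_mul_of_nonneg_left harith (by positivity)
    calc ‖linQcov L (avgIter L U₀ j) G ((L : ℤ) • z) κ‖
        ≤ avQ L (fun x κ' => ‖G x κ'‖) ((L : ℤ) • z) κ + θ * s * (L : ℝ) * ddQ L (fun x κ' => ‖G x κ'‖) ((L : ℤ) • z) κ := h1
      _ ≤ (‖X‖ * kerQ L (j + 1) z κ y μ + C * ((2 * (L : ℝ) - 1) * W))
            + θ * s * (L : ℝ) * (‖X‖ * ((L : ℝ) ^ j * W) + C * (2 * d * W)) :=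
          add_le_add hav (mul_le_mul_of_nonneg_left hdd hθsL)
      _ = ‖X‖ * kerQ L (j + 1) z κ y μ
            + θ * s * (L : ℝ) ^ j * ‖X‖ * W * ((2 * L - 1) + L + 2 * d * θ * s * L) := by rw [hC]; ring
      _ ≤ ‖X‖ * kerQ L (j + 1) z κ y μ + θ * s * (L : ℝ) ^ j * ‖X‖ * W * (L : ℝ) ^ 3 := add_le_add le_rfl key
      _ = (kerQ L (j + 1) z κ y μ + θ * ((L : ℝ) ^ 2 * s) * (L : ℝ) ^ (j + 1) * W) * ‖X‖ := by rw [pow_succ]; ring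

include hL hθ h139 h145 in
/-- **(146)/(147) PER BOND**: `‖LʲηQ_j(U₀)(X·δ_b)(c)‖ ≤ (1 + θ(Lʲη)²)·Lʲ·L^{−jd}·‖X‖` — «|Q_k(U₀)A| ≦ Q_k|A| + 2C′₁α₀Q″_k|A| ≦
(1 + 2C′₁α₀)Q″_k|A|» and «|Q_k(U₀; c, b)| ≦ 1 + 2C′₁α₀» (at `j = k`, `Lᵏη = 1`: the coefficient of `X` is `(1 + θ)·Lᵏ·η^d`, the
`Lᵏ` being the un-normalisation `B = ηA` and `η^d` the weight of (138)); uses «Q_k ≦ Q″_k» per column (`kerQ_le`).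
[cite: Balaban1985Averaging, (146)–(147) p.40, (138) p.39] -/
theorem ineq147 (y : Site d) (μ : Fin d) (X : 𝔸) {j : ℕ} (hj : j ≤ k) (x : Site d) (κ : Fin d) :
    ‖linCovIter L U₀ (bump y μ X) j x κ‖ ≤
      (1 + θ * ((L : ℝ) ^ j * ((L : ℝ) ^ k)⁻¹) ^ 2) * ((L : ℝ) ^ j * (((L : ℝ) ^ j) ^ d)⁻¹) * ‖X‖ := by
  have h := ineq143 L hL U₀ k hθ h139 h145 y μ X j hj x κ
  have h1 := kerQ_le L j x κ y μ
  have h2 := kerQdd_le L j x κ y μ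
  have h3 := kerQdd_nonneg L j x κ y μ
  refine h.trans (mul_le_mul_of_nonneg_right ?_ (norm_nonneg X))
  have hLj : (0 : ℝ) ≤ (L : ℝ) ^ j := by positivity
  have hθs : 0 ≤ θ * ((L : ℝ) ^ j * ((L : ℝ) ^ k)⁻¹) ^ 2 := by positivity
  calc kerQ L j x κ y μ + θ * ((L : ℝ) ^ j * ((L : ℝ) ^ k)⁻¹) ^ 2 * (L : ℝ) ^ j * kerQdd L j x κ y μ
      ≤ (L : ℝ) ^ j * kerQdd L j x κ y μ + θ * ((L : ℝ) ^ j * ((L : ℝ) ^ k)⁻¹) ^ 2 * (L : ℝ) ^ j * kerQdd L j x κ y μ :=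
        add_le_add h1 le_rfl
    _ = (1 + θ * ((L : ℝ) ^ j * ((L : ℝ) ^ k)⁻¹) ^ 2) * ((L : ℝ) ^ j * kerQdd L j x κ y μ) := by ring
    _ ≤ (1 + θ * ((L : ℝ) ^ j * ((L : ℝ) ^ k)⁻¹) ^ 2) * ((L : ℝ) ^ j * (((L : ℝ) ^ j) ^ d)⁻¹) :=
        mul_le_mul_of_nonneg_left (mul_le_mul_of_nonneg_left h2 hLj) (by positivity)

include hL hθ h139 h145 in
/-- **LOCALITY OF THE COMPOSED LINEAR PART** — (147)'s kernel `Q_j(U₀; c, b)` vanishes unless `b ⊂ Bʲ(c₋) ∪ Bʲ(c₊)` (Prop. 4: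
«an analytic function of the variables A_b, b ⊂ B^k(c₋) ∪ B^k(c₊)»). [cite: Balaban1985Averaging, Prop. 4 p.38, (141) p.39, (147) p.40] -/
theorem linCovIter_bump_eq_zero (y : Site d) (μ : Fin d) (X : 𝔸) {j : ℕ} (hj : j ≤ k) (x : Site d) (κ : Fin d)
    (hb : ¬ BondIn (loK L j x) (bondHiK L j x κ) y μ) : linCovIter L U₀ (bump y μ X) j x κ = 0 := by
  have h := ineq143 L hL U₀ k hθ h139 h145 y μ X j hj x κ
  rw [kerQ_of_not_bondIn hb, kerQdd_of_not_bondIn hb, mul_zero, zero_add, zero_mul] at h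
  exact norm_le_zero_iff.1 h

end Levels

end Literature.MathematicalPhysics.QuantumFieldTheory.Balaban1983to89.B7Prop5GeneralLinear

end
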